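import Summits.AtomisticToContinuum.Crystallization.Theses.ThreeConeCertificate
import Summits.AtomisticToContinuum.Crystallization.Theorems.ThreeConeCertificateExactCertificateNoGapPeriodic

/-!
# Sketch (crux-ideate round 2, ideator 5) — first lemmas of the idea `robust-soft-flyspeck`
for crux stmt-AtomisticToContinuum-11959 `ThreeConeCertificate.ExactCertificate`.

Signatures only need to elaborate (crux-ideate protocol); `sorry` allowed here.
-/

noncomputable section

namespace Summit.AtomisticToContinuum.Crystallization.Cruxes.ExactCertificate.Ideator5

open Literature.MathematicalPhysics.StatisticalMechanics
open Summit.AtomisticToContinuum.Crystallization.Theses.ThreeConeCertificate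
open scoped BigOperators

abbrev E3 := EuclideanSpace ℝ (Fin 3)

/-- FIRST LEMMA (local-to-global with zero-sum transfers, periodic form).
If a site functional "fair share of `g` plus transfer `T`" is bounded below by `−c` at every site of
every periodic configuration, and the transfers sum to zero over each motif (antisymmetric,
lattice-equivariant bookkeeping), then `−c` bounds the periodic energy per particle of `g` from below.
With the tree's `NoGap.stable_of_periodic_bound` this makes `g` `c`-stable on all finite injective
configurations (clause (S5) of the crux) whenever `g` has finite range. -/
theorem energyPerParticle_ge_of_localInequality
    (g : ℝ → ℝ) (c : ℝ) (T : PeriodicConfiguration 3 → E3 → ℝ)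
    (hzero : ∀ Q : PeriodicConfiguration 3, ∑ x ∈ Q.motif, T Q x = 0)
    (hloc : ∀ (Q : PeriodicConfiguration 3) (x : E3), x ∈ Q.motif →
        -c ≤ (2 : ℝ)⁻¹ * (∑' y : {y : E3 // y ∈ Q.points ∧ y ≠ x}, g (dist x y.1)) + T Q x) :
    ∀ Q : PeriodicConfiguration 3, -c ≤ Q.energyPerParticle g := by
  sorry

/-- COMPOSITION TARGET of the line (design + robust local inequality ⇒ the crux, with `KeplerBound`
as OUTPUT): an explicit template `P₀`, range `ρ`, a compact family `𝒩` of admissible positive-type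
parts (all `f` with prescribed jets at the finitely many shells of `P₀` below `ρ` up to tolerance),
ONE member `f ∈ 𝒩` satisfying the tail conditions, and a local inequality certified uniformly over
`𝒩` give `ExactCertificate`.  Stated here in the collapsed form the gate can type: a periodic lower
bound for the designed core at the template's own value. -/
theorem exactCertificate_of_design_and_periodicCoreBound
    (P₀ : PeriodicConfiguration 3) (ρ : ℝ) (f : ℝ → ℝ)
    (hpd : ∀ (n : ℕ) (y : Fin n → E3) (w : Fin n → ℝ), 0 ≤ ∑ i, ∑ j, w i * w j * f (dist (y i) (y j)))
    (htail : ∀ r : ℝ, ρ ≤ r → 0 < r → f r ≤ lennardJones r)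
    (hcore : ∀ Q : PeriodicConfiguration 3,
        P₀.energyPerParticle lennardJones + f 0 / 2 ≤
          Q.energyPerParticle (fun r => if r < ρ then lennardJones r - f r else 0)) :
    ExactCertificate := by
  sorry

end Summit.AtomisticToContinuum.Crystallization.Cruxes.ExactCertificate.Ideator5
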